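import Summits.CriticalPhenomena.PercolationContinuityZ3.Theorems.PercNearOneGluingNoHeavyPcintChordRandReduction
import Summits.CriticalPhenomena.PercolationContinuityZ3.Theorems.PercNearOneGluingNoHeavyPcintNawChainReduction
import HarnessLib

/-!
# PCINT lane, reduction B3c (`chordchain_cw`): the unit structure of a word (full information)

Cell `prim-pcint` (PAPER-2 track (iii): certified intervals for `p_c(ℤ^d)`), seat `prim-pcint-2` (gen 4); support file
(`--supports stmt-CriticalPhenomena-4575`).  Does NOT build on p205010.  Memo: `run/shared/lean/prim/pcint/REDUCTIONS.md` §B3c.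

For a word `γ`, an off-path site `w` with incidence times `t_0 < t_1 < … < t_{r-1}` (`incTimes`, `incAt` of
`…PcintChordRandPairs`) and a chain parameter `kc ≥ 2`, the FULL-INFORMATION B3c bookkeeping pays the unit
`s = (1-p²)^{1/2}`:
* at incidence `k ≥ 1` ("base unit", `ChainBond.paysAt`) iff the pair `(t_{k-1}, t_k)` is LINKED (`t_k - t_{k-1} ≤ kc`) and is
  not the corner first pair (`k = 1`, `t_1 = t_0 + 2`: that pair is paid through the corner coin, two units);
* for incidence `k - 1` as a BONUS at incidence `k` (`ChainBond.bonusAt`) iff the base unit at `k` is paid and `t_{k-1}` starts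
  its chain (`k = 1` or `(t_{k-2}, t_{k-1})` not linked).
`ChainBond.detUnits kc γ w` is the number of these (order-independent) units; PROVED: every incidence carries at most one
unit and the two incidences of a corner first pair carry none (`detUnits_add_le`: `detUnits + 2·[firstCorner] ≤ r`).
Also: the off-path sites `offSites γ`, and for a bad corner time `s` the site `cornerSite γ s` is an off-path site whose
first pair is `(s, s+2)` (`firstCorner_of_badTime`, `incAt_zero_of_isCorner`); distinct bad corners at one site are
impossible (`card_badFiber_le_one`).  The B3c weight `chainBondWeight` and the probabilistic reduction are in
`…PcintChainBondEvent` / `…PcintChainBondReduction`; the pure inequality in `…PcintChainBondIneq`.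
-/

noncomputable section

namespace Summit.CriticalPhenomena.PercolationContinuityZ3.Theorems.Pcint

open Finset Literature.Probability.Percolation Literature.Probability.LatticeModels

variable {d n : ℕ}

namespace ChainBond

/-! ### Off-path sites -/

/-- The OFF-PATH SITES adjacent to the path of a word. [folklore] -/
def offSites (γ : Fin n → Fin d × Bool) : Finset (Site d) :=
  ((range (n + 1)).biUnion fun t => nbrSites (wordPos γ t)).filter fun w => w ∉ pathSites γ

/-- Membership in `offSites`. [folklore] -/
theorem mem_offSites {γ : Fin n → Fin d × Bool} {w : Site d} :
    w ∈ offSites γ ↔ w ∉ pathSites γ ∧ ∃ t ≤ n, (zdGraph d).Adj (wordPos γ t) w := by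
  simp only [offSites, mem_filter, mem_biUnion, mem_range, Nat.lt_succ_iff, mem_nbrSites]
  tauto

/-- An off-path site with an incidence time is an off-path site of the word. [folklore] -/
theorem mem_offSites_of_mem_incTimes {γ : Fin n → Fin d × Bool} {w : Site d} (hw : w ∉ pathSites γ) {t : ℕ}
    (ht : t ∈ incTimes γ w) : w ∈ offSites γ :=
  mem_offSites.2 ⟨hw, t, (mem_incTimes.1 ht).1, (mem_incTimes.1 ht).2⟩

/-! ### Linked pairs, base units, bonus units -/

/-- Incidence `k ≥ 1` is LINKED to its predecessor: `t_k ≤ t_{k-1} + kc`. [folklore] -/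
def linkedAt (kc : ℕ) (γ : Fin n → Fin d × Bool) (w : Site d) (k : ℕ) : Prop :=
  1 ≤ k ∧ incAt γ w k ≤ incAt γ w (k - 1) + kc

/-- The first pair of the site is a CORNER pair: at least two incidences and `t_1 = t_0 + 2`. [folklore] -/
def firstCorner (γ : Fin n → Fin d × Bool) (w : Site d) : Prop :=
  2 ≤ (incTimes γ w).card ∧ incAt γ w 1 = incAt γ w 0 + 2

/-- The BASE UNIT of incidence `k`: `1 ≤ k < r`, linked, and not the corner first pair. [folklore] -/
def paysAt (kc : ℕ) (γ : Fin n → Fin d × Bool) (w : Site d) (k : ℕ) : Prop :=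
  1 ≤ k ∧ k < (incTimes γ w).card ∧ linkedAt kc γ w k ∧ ¬ (k = 1 ∧ firstCorner γ w)

/-- The BONUS UNIT paid at incidence `k` for incidence `k - 1`: the base unit at `k` is paid and incidence `k - 1` starts its
chain. [folklore] -/
def bonusAt (kc : ℕ) (γ : Fin n → Fin d × Bool) (w : Site d) (k : ℕ) : Prop :=
  paysAt kc γ w k ∧ (k = 1 ∨ ¬ linkedAt kc γ w (k - 1))

/-- `linkedAt` is decidable. [folklore] -/
instance linkedAt.decidable (kc : ℕ) (γ : Fin n → Fin d × Bool) (w : Site d) (k : ℕ) : Decidable (linkedAt kc γ w k) := by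
  unfold linkedAt; infer_instance

/-- `firstCorner` is decidable. [folklore] -/
instance firstCorner.decidable (γ : Fin n → Fin d × Bool) (w : Site d) : Decidable (firstCorner γ w) := by
  unfold firstCorner; infer_instance

/-- `paysAt` is decidable. [folklore] -/
instance paysAt.decidable (kc : ℕ) (γ : Fin n → Fin d × Bool) (w : Site d) (k : ℕ) : Decidable (paysAt kc γ w k) := by
  unfold paysAt; infer_instance

/-- `bonusAt` is decidable. [folklore] -/
instance bonusAt.decidable (kc : ℕ) (γ : Fin n → Fin d × Bool) (w : Site d) (k : ℕ) : Decidable (bonusAt kc γ w k) := by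
  unfold bonusAt; infer_instance

/-- The base-unit indices. [folklore] -/
def paySet (kc : ℕ) (γ : Fin n → Fin d × Bool) (w : Site d) : Finset ℕ :=
  (range (incTimes γ w).card).filter fun k => paysAt kc γ w k

/-- The bonus-unit indices (the index AT which the bonus is paid). [folklore] -/
def bonusSet (kc : ℕ) (γ : Fin n → Fin d × Bool) (w : Site d) : Finset ℕ :=
  (range (incTimes γ w).card).filter fun k => bonusAt kc γ w k

/-- The number of order-independent units of the site. [folklore] -/
def detUnits (kc : ℕ) (γ : Fin n → Fin d × Bool) (w : Site d) : ℕ := (paySet kc γ w).card + (bonusSet kc γ w).card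

/-- Membership in `paySet`. [folklore] -/
theorem mem_paySet {kc : ℕ} {γ : Fin n → Fin d × Bool} {w : Site d} {k : ℕ} : k ∈ paySet kc γ w ↔ paysAt kc γ w k := by
  rw [paySet, mem_filter, mem_range]
  exact ⟨fun h => h.2, fun h => ⟨h.2.1, h⟩⟩

/-- Membership in `bonusSet`. [folklore] -/
theorem mem_bonusSet {kc : ℕ} {γ : Fin n → Fin d × Bool} {w : Site d} {k : ℕ} :
    k ∈ bonusSet kc γ w ↔ bonusAt kc γ w k := by
  rw [bonusSet, mem_filter, mem_range]
  exact ⟨fun h => h.2, fun h => ⟨h.1.2.1, h⟩⟩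

/-- **Every incidence carries at most one unit, and the corner first pair carries none of the order-independent ones**:
`detUnits + 2·[firstCorner] ≤ r` (for `kc ≥ 2`). [folklore] -/
theorem detUnits_add_le {kc : ℕ} (hkc : 2 ≤ kc) (γ : Fin n → Fin d × Bool) (w : Site d) :
    detUnits kc γ w + (if firstCorner γ w then 2 else 0) ≤ (incTimes γ w).card := by
  classical
  set r := (incTimes γ w).card with hr
  set P := paySet kc γ w with hP
  set B := bonusSet kc γ w with hB
  set B' := B.image fun k => k - 1 with hB'
  have hBinj : Set.InjOn (fun k => k - 1) ↑B := by
    intro k hk k' hk' h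
    have h1 := (mem_bonusSet.1 (mem_coe.1 hk)).1.1
    have h1' := (mem_bonusSet.1 (mem_coe.1 hk')).1.1
    simp only at h; omega
  have hcardB' : B'.card = B.card := card_image_of_injOn hBinj
  have hdisj : Disjoint P B' := by
    rw [disjoint_left]
    intro k hkP hkB'
    obtain ⟨k1, hk1, hk1k⟩ := mem_image.1 hkB'
    have hb := mem_bonusSet.1 hk1
    have hp := mem_paySet.1 hkP
    have hk1eq : k1 = k + 1 := by have := hb.1.1; omega
    rw [hk1eq] at hb
    rcases hb.2 with h | h
    · have := hp.1; omega
    · rw [Nat.add_sub_cancel] at h; exact h hp.2.2.1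
  set S : Finset ℕ := if firstCorner γ w then {0, 1} else ∅ with hS
  have hSsub : S ⊆ range r := by
    rw [hS]; split_ifs with hfc
    · intro x hx
      rw [mem_range]
      have := hfc.1
      rcases mem_insert.1 hx with rfl | hx
      · omega
      · rw [mem_singleton.1 hx]; omega
    · exact empty_subset _
  have hcardS : S.card = if firstCorner γ w then 2 else 0 := by
    rw [hS]; split_ifs <;> simp
  have hsub : P ∪ B' ⊆ range r \ S := by
    intro k hk
    rw [mem_sdiff, mem_range]
    rcases mem_union.1 hk with hk | hk
    · have hp := mem_paySet.1 hk
      refine ⟨hp.2.1, fun hkS => ?_⟩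
      rw [hS] at hkS
      split_ifs at hkS with hfc
      · rcases mem_insert.1 hkS with rfl | hk1
        · exact absurd hp.1 (by omega)
        · rw [mem_singleton.1 hk1] at hp; exact hp.2.2.2 ⟨rfl, hfc⟩
      · simp at hkS
    · obtain ⟨k1, hk1, rfl⟩ := mem_image.1 hk
      have hb := mem_bonusSet.1 hk1
      refine ⟨by have := hb.1.2.1; omega, fun hkS => ?_⟩
      rw [hS] at hkS
      split_ifs at hkS with hfc
      · rcases mem_insert.1 hkS with h0 | h1
        · have hk1eq : k1 = 1 := by have := hb.1.1; omega
          rw [hk1eq] at hb; exact hb.1.2.2.2 ⟨rfl, hfc⟩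
        · rw [mem_singleton] at h1
          have hk1eq : k1 = 2 := by have := hb.1.1; omega
          rw [hk1eq] at hb
          rcases hb.2 with h | h
          · omega
          · exact h (show 1 ≤ 1 ∧ incAt γ w 1 ≤ incAt γ w 0 + kc from ⟨le_rfl, by rw [hfc.2]; omega⟩)
      · simp at hkS
  calc detUnits kc γ w + (if firstCorner γ w then 2 else 0) = (P ∪ B').card + S.card := by
        rw [detUnits, ← hP, ← hB, ← hcardB', card_union_of_disjoint hdisj, hcardS]
    _ ≤ (range r \ S).card + S.card := by gcongr
    _ = r := by rw [card_sdiff_of_subset hSsub, card_range, Nat.sub_add_cancel ((card_le_card hSsub).trans (card_range r).le)]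

/-- With at most one incidence there is no unit. [folklore] -/
theorem detUnits_eq_zero_of_card_le_one {kc : ℕ} {γ : Fin n → Fin d × Bool} {w : Site d}
    (h : (incTimes γ w).card ≤ 1) : detUnits kc γ w = 0 := by
  have hP : paySet kc γ w = ∅ := by
    rw [Finset.eq_empty_iff_forall_notMem]; intro k hk; obtain ⟨h1, h2, -⟩ := mem_paySet.1 hk; omega
  have hB : bonusSet kc γ w = ∅ := by
    rw [Finset.eq_empty_iff_forall_notMem]; intro k hk; obtain ⟨h1, h2, -⟩ := (mem_bonusSet.1 hk).1; omega
  rw [detUnits, hP, hB, card_empty]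

/-! ### Bad corners as first pairs of their corner sites -/

/-- The incidence times of a corner site start with the corner: `incAt 0 = s` and `incAt 1 = s + 2`, and there are at least
two of them. [folklore] -/
theorem incAt_zero_of_isCorner {γ : Fin n → Fin d × Bool} {s : ℕ} (hc : IsCorner γ s) :
    2 ≤ (incTimes γ (cornerSite γ s)).card ∧ incAt γ (cornerSite γ s) 0 = s ∧ incAt γ (cornerSite γ s) 1 = s + 2 := by
  obtain ⟨h, -, -, hno⟩ := hc
  set w := cornerSite γ s with hw
  have hs : s ∈ incTimes γ w := mem_incTimes.2 ⟨by omega, adj_wordPos_cornerSite h⟩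
  have hs2 : s + 2 ∈ incTimes γ w := mem_incTimes.2 ⟨h, adj_wordPos_add_two_cornerSite h⟩
  have hr : 2 ≤ (incTimes γ w).card := by
    calc 2 = ({s, s + 2} : Finset ℕ).card := by rw [card_pair (by omega)]
      _ ≤ _ := card_le_card fun x hx => by
          rcases mem_insert.1 hx with rfl | hx
          · exact hs
          · rw [mem_singleton.1 hx]; exact hs2
  -- every incidence time is ≥ s
  have hge : ∀ t ∈ incTimes γ w, s ≤ t := by
    intro t ht
    by_contra hlt
    exact hno t (mem_range.2 (by omega)) (mem_incTimes.1 ht).2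
  have h0 : incAt γ w 0 = s := by
    obtain ⟨k, hk, hks⟩ := exists_incAt_eq hs
    have hk0 : incAt γ w 0 ≤ incAt γ w k := by
      rcases Nat.eq_zero_or_pos k with rfl | hpos
      · exact le_rfl
      · exact (incAt_strictMono hpos hk).le
    have := hge _ (incAt_mem (by omega : 0 < (incTimes γ w).card))
    omega
  refine ⟨hr, h0, ?_⟩
  obtain ⟨k, hk, hks2⟩ := exists_incAt_eq hs2
  have hk1 : 1 ≤ k := by
    by_contra hk0
    have : k = 0 := by omega
    subst this; omega
  have h01 : incAt γ w 0 < incAt γ w 1 := incAt_strictMono zero_lt_one (by omega)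
  have hgap : incAt γ w 0 + 2 ≤ incAt γ w 1 := incTimes_gap (incAt_mem (by omega)) (incAt_mem (by omega)) h01
  have h1k : incAt γ w 1 ≤ incAt γ w k := by
    rcases Nat.lt_or_ge 1 k with hlt | hge1
    · exact (incAt_strictMono hlt hk).le
    · have : k = 1 := by omega
      subst this; exact le_rfl
  omega

/-- A bad corner time makes the first pair of its corner site a corner pair. [folklore] -/
theorem firstCorner_of_badTime {o : Orders d n} {γ : Fin n → Fin d × Bool} {s : Fin n} (hs : s ∈ badTimes o γ) :
    firstCorner γ (cornerSite γ s) := by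
  obtain ⟨hr, h0, h1⟩ := incAt_zero_of_isCorner (mem_badTimes.1 hs).1
  exact ⟨hr, by rw [h0, h1]⟩

/-- The corner site of a corner time is an off-path site of the word. [folklore] -/
theorem cornerSite_mem_offSites {γ : Fin n → Fin d × Bool} {s : ℕ} (hc : IsCorner γ s) : cornerSite γ s ∈ offSites γ := by
  obtain ⟨h, -, hoff, -⟩ := hc
  exact mem_offSites.2 ⟨hoff, s, by omega, adj_wordPos_cornerSite h⟩

open Classical in
/-- The bad corner times whose corner site is `w`. [folklore] -/
def badFiber (o : Orders d n) (γ : Fin n → Fin d × Bool) (w : Site d) : Finset (Fin n) :=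
  (badTimes o γ).filter fun s => cornerSite γ s = w

/-- A bad corner time in the fibre of `w` is the first incidence of `w`. [folklore] -/
theorem eq_incAt_zero_of_mem_badFiber {o : Orders d n} {γ : Fin n → Fin d × Bool} {w : Site d} {s : Fin n}
    (hs : s ∈ badFiber o γ w) : (s : ℕ) = incAt γ w 0 ∧ firstCorner γ w ∧ IsBad o γ s := by
  classical
  obtain ⟨hbt, hw⟩ := mem_filter.1 hs
  obtain ⟨hc, hbad⟩ := mem_badTimes.1 hbt
  obtain ⟨-, h0, -⟩ := incAt_zero_of_isCorner hc
  have hfc := firstCorner_of_badTime hbt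
  rw [hw] at h0 hfc
  exact ⟨h0.symm, hfc, hbad⟩

/-- **At most one bad corner per site.** [folklore] -/
theorem card_badFiber_le_one (o : Orders d n) (γ : Fin n → Fin d × Bool) (w : Site d) : (badFiber o γ w).card ≤ 1 := by
  refine card_le_one.2 fun s hs s' hs' => ?_
  have h1 := (eq_incAt_zero_of_mem_badFiber hs).1
  have h2 := (eq_incAt_zero_of_mem_badFiber hs').1
  exact Fin.ext (by omega)

/-- **The bad corner times are counted site by site**: `Σ_{w ∈ offSites} #badFiber w = #badTimes`. [folklore] -/
theorem sum_card_badFiber (o : Orders d n) (γ : Fin n → Fin d × Bool) :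
    ∑ w ∈ offSites γ, (badFiber o γ w).card = (badTimes o γ).card := by
  classical
  unfold badFiber
  exact (card_eq_sum_card_fiberwise fun s hs => cornerSite_mem_offSites (mem_badTimes.1 (mem_coe.1 hs)).1).symm

/-! ### The B3c weight -/

/-- The total number of order-independent units of a word. [folklore] -/
def detTotal (kc : ℕ) (γ : Fin n → Fin d × Bool) : ℕ := ∑ w ∈ offSites γ, detUnits kc γ w

/-- The symmetric (order-averaged) B3c weight of a word:
`pⁿ (1-p)^{#chords} s^{detTotal} ((1+s²)/2)^{cornerTotal}`. [folklore] -/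
def chainBondWeight (p s : ℝ) (kc : ℕ) (γ : Fin n → Fin d × Bool) : ℝ :=
  p ^ n * (1 - p) ^ (chordEdges γ).card * s ^ detTotal kc γ * ((1 + s ^ 2) / 2) ^ cornerTotal γ

end ChainBond

end Summit.CriticalPhenomena.PercolationContinuityZ3.Theorems.Pcint
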